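import Summits.Langlands.Langlands.Theorems.IrreducibilityBySelfDualityIrreducibleOffSectorTransfer
import Literature.NumberTheory.Automorphic.ArtinAutomorphy
import Literature.NumberTheory.GaloisRepresentations.FramedRepDualIrreducible
import Literature.NumberTheory.GaloisRepresentations.FramedRepDualProofs
import Literature.NumberTheory.GaloisRepresentations.FramedRepBaseChange
import Literature.NumberTheory.GaloisRepresentations.ArtinReciprocityCharacterProofs
import Literature.NumberTheory.GaloisRepresentations.GlobalArtinMapOfCharactersProofs
import HarnessLib

/-!
# The Galois-type region of `IrreducibleOffSector`: `π = π(σ)` for an irreducible Artin `σ`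
(crux stmt-Langlands-14329 `IrreducibilityBySelfDuality.IrreducibleOffSector`, route
`route-Langlands-IrreducibilityBySelfDuality`, line `Sketch`; `--supports` file, lead c3)

`IrreducibleOffSector` (Ramakrishnan's "cuspidal ⇒ irreducible", off the sector
`n = 3 ∧ K CM ∧ regular`) quantifies over EVERY `ρ : Γ_K →ₜ* GL_n(ℚ̄_ℓ)` Satake–Frobenius compatible
with `(π, ι)` at almost all places.  By the Chebotarev–Brauer–Nesbitt transfer
(`isIrreducible_of_satakeFrobCompatible`, p79199) it is settled for a given `π` as soon as ONE
irreducible compatible avatar is exhibited.  This file exhibits it on the **Galois-type region**: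
`π = π(σ)` in Tunnell's sense (`IsPiOfArtinRep σ π` of `StrongArtinGL2`, or its byte-identical fact-free
copy `ArtinAutomorphy.IsPiOfArtinRep σ π`: at almost every place `π_v` is
unramified with Satake parameter `α`, `σ` is unramified and its arithmetic Frobenius has
characteristic polynomial `∏_{a ∈ α} (X - a)`) for an IRREDUCIBLE Artin representation
`σ : Γ_K → GL_n(ℂ)`.  The avatar is the `ℓ`-adic transport of the CONTRAGREDIENT, `g ↦ ι⁻¹(((σ g)⁻¹)ᵀ)`:
continuous because its kernel contains the open kernel of `σ` (`FramedArtinRep.isOpen_ker_toMonoidHom`),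
unramified exactly where `σ` is, with arithmetic-Frobenius characteristic polynomial
`∏ (X - ι⁻¹(a⁻¹)) = arithFrobPolyOfSatake ι q_v 1 α` (the summit's L-normalisation: geometric
Frobenius ↔ uniformiser, Buzzard–Gee Rem. 3.2.5) — the inversion `a ↦ a⁻¹` is exactly the passage
to the contragredient (`Matrix.charpoly_inv`) — and irreducible because duality
(`FramedRep.isIrreducible_dual`) and transport of structure along the field isomorphism `ι⁻¹`
(`isIrreducible_of_semilinear_transport`) preserve irreducibility.

Results (every rank `n`, every number field `K`, every prime `ℓ`, every `ι`; no cuspidality,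
algebraicity or regularity hypothesis on `π`; unconditional — standard axioms only):

* `exists_lAdicDualTransport` — the transport `ρ₀` of `σ^∨` along `ι⁻¹`, with its matrix formula,
  the kernel dictionary `ρ₀ g = 1 ↔ σ g = 1`, and irreducibility from that of `σ`;
* `eventually_satakeFrobCompatibleAt_lAdicDualTransport` — `π = π(σ)` ⇒ `ρ₀` is Satake–Frobenius
  compatible with `(π, ι)` at almost all places;
* `exists_irreducible_avatar_of_isPiOfArtinRep` — hence an irreducible a.e.-compatible avatar exists;
* `isIrreducible_of_isPiOfArtinRep` — **the region**: every a.e.-compatible `ρ` is irreducible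
  (the binder-shape / on-route corollaries live in the sequel `…ArtinTypeOnRoute`).

This Galois-type slice is not covered by name in the certified map of the open content
(`irreducibleOffSector_text_of_open_regions`, p118444): it needs neither Buzzard–Gee 3.1.6 nor any
reciprocity input and allows IRREGULAR `π` (weight one, Maass `¼` of Galois type) in every rank.  It
re-does the content of p80340 (pitem prover), bounced only by a gate restart and never re-landed.
References: Tunnell, Bull. AMS 5 (1981) p. 173; Deligne–Serre, ASENS 7 (1974), Lemme 3.2, §8;
Serre, *Abelian ℓ-adic representations* (1968), Ch. I §1.1 Remark, Ch. III §2.3; Buzzard–Gee (2014),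
§2.1, Rem. 3.2.5; Ramakrishnan, *Irreducibility and cuspidality* (2008), Introduction.
-/

noncomputable section

-- `Summit.Langlands.Langlands.…` (summit = sub-problem name, D-0017 layout) trips `dupNamespace`.
set_option linter.dupNamespace false

open scoped NumberField Classical Polynomial Matrix
open Filter IsDedekindDomain Polynomial
open Literature.NumberTheory.Automorphic Literature.NumberTheory.GaloisRepresentations

namespace Summit.Langlands.Langlands.Theorems.IrreducibleOffSector

/-! ## 1. Linear algebra: the characteristic polynomial of an inverse matrix -/

section LinearAlgebra

variable {F : Type*} [Field F]

/-- `reverse` is multiplicative on multiset products of polynomials over a field. [folklore] -/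
theorem reverse_multisetProd (s : Multiset F[X]) : s.prod.reverse = (s.map reverse).prod := by
  -- adapted from Summits/…/PicardMuOrdinaryMuOrdinaryFamilyRTDictionary.lean (`reverse_multiset_prod`)
  induction s using Multiset.induction_on with
  | empty => simpa using reverse_C (1 : F)
  | cons a s ih => simp [reverse_mul_of_domain, ih]

/-- `reverse (X - c) = 1 - c X`. [folklore] -/
theorem reverse_X_sub_C_eq (c : F) : (X - C c : F[X]).reverse = 1 - C c * X := by
  -- adapted from Summits/…/PicardMuOrdinaryMuOrdinaryFamilyRTDictionary.lean (`reverse_X_sub_C`)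
  rw [sub_eq_add_neg, ← C_neg, reverse_add_C, natDegree_X]
  have h1 : (1 : F[X]).reverse = 1 := by simpa using reverse_C (1 : F)
  have : (X : F[X]).reverse = 1 := by simpa [h1] using reverse_mul_X (1 : F[X])
  rw [this, C_neg]; ring

/-- **Characteristic polynomial of the inverse.**  If an invertible matrix `M` over a field has
`charpoly M = ∏_{c ∈ s} (X - c)`, then `charpoly M⁻¹ = ∏_{c ∈ s} (X - c⁻¹)` (Mathlib
`Matrix.charpoly_inv`: `charpoly M⁻¹ = (-1)ⁿ (det M)⁻¹ · reverse (charpoly M)`, with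
`reverse (X - c) = -c (X - c⁻¹)` for `c ≠ 0` and `det M = ∏ c`). [folklore] -/
theorem charpoly_inv_eq_prod_of_charpoly_eq_prod {m : Type*} [Fintype m] [DecidableEq m]
    {M : Matrix m m F} (hM : IsUnit M) {s : Multiset F}
    (h : M.charpoly = (s.map fun c => X - C c).prod) :
    M⁻¹.charpoly = (s.map fun c => X - C c⁻¹).prod := by
  -- adapted from Summits/…/PicardMuOrdinaryMuOrdinaryFamilyRTDictionary.lean (`charpoly_inv_of_charpoly_eq_prod`)
  have hcard : Multiset.card s = Fintype.card m := by
    have := congrArg natDegree h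
    rwa [Matrix.charpoly_natDegree_eq_dim, natDegree_multiset_prod_X_sub_C_eq_card, eq_comm] at this
  have hdet : M.det = s.prod := by
    rw [Matrix.det_eq_sign_charpoly_coeff, h, coeff_zero_eq_eval_zero, eval_multiset_prod,
      Multiset.map_map]
    simp only [Function.comp_def, eval_sub, eval_X, eval_C, zero_sub]
    rw [Multiset.prod_map_neg, hcard, ← mul_assoc, ← pow_add, ← two_mul, pow_mul]
    simp
  have hdet0 : M.det ≠ 0 := ((Matrix.isUnit_iff_isUnit_det M).mp hM).ne_zero
  have hs0 : ∀ c ∈ s, c ≠ 0 := fun c hc h0 => hdet0 (hdet ▸ Multiset.prod_eq_zero (h0 ▸ hc))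
  rw [Matrix.charpoly_inv M hM, ← Matrix.reverse_charpoly, h, reverse_multisetProd,
    Multiset.map_map]
  have h1 : (s.map (reverse ∘ fun c => X - C c)) = s.map (fun c => C (-c) * (X - C c⁻¹)) := by
    refine Multiset.map_congr rfl fun c hc => ?_
    simp only [Function.comp_def, reverse_X_sub_C_eq]
    rw [C_neg, neg_mul, mul_sub, ← C_mul, mul_inv_cancel₀ (hs0 c hc), C_1]
    ring
  have h2 : (s.map fun c => C (-c)).prod = C ((-1) ^ Fintype.card m * s.prod) := by
    rw [← hcard, ← Multiset.prod_map_neg, map_multiset_prod, Multiset.map_map]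
    rfl
  have h3 : ((-1 : F[X]) ^ Fintype.card m * C (s.prod)⁻¹ * C ((-1) ^ Fintype.card m * s.prod)) =
      1 := by
    rw [← C_1, ← C_neg, ← C_pow, ← C_mul, ← C_mul]
    congr 1
    rw [mul_comm ((-1 : F) ^ _) s.prod, ← mul_assoc, mul_assoc _ _ s.prod,
      inv_mul_cancel₀ (hdet ▸ hdet0), mul_one, ← pow_add, ← two_mul, pow_mul]
    simp
  rw [h1, Multiset.prod_map_mul, Ring.inverse_eq_inv', hdet, h2, ← mul_assoc, h3, one_mul]

/-- A product `∏_{a ∈ α} (X - f a)` is mapped by a ring homomorphism `φ` to `∏_{a ∈ α} (X - φ (f a))`.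
[folklore] -/
theorem map_multisetProd_X_sub_C {S : Type*} [Field S] (φ : F →+* S) {ι' : Type*}
    (α : Multiset ι') (f : ι' → F) :
    ((α.map fun a => X - C (f a)).prod).map φ = (α.map fun a => X - C (φ (f a))).prod := by
  rw [Polynomial.map_multiset_prod, Multiset.map_map]
  refine congrArg Multiset.prod (Multiset.map_congr rfl fun a _ => ?_)
  simp only [Function.comp_apply, Polynomial.map_sub, map_X, map_C]

end LinearAlgebra

/-! ## 2. Transport of irreducibility along a field isomorphism `A ≃+* B` -/

section Transport

variable {G : Type*} [Monoid G] {A B : Type*} [Field A] [Field B] {n : ℕ}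

/-- **Irreducibility is transported along a field isomorphism.**  Let `e : A ≃+* B` and let
`ρA`, `ρB` be representations of `G` on `Aⁿ`, `Bⁿ` intertwined by the `e`-semilinear bijection
`x ↦ e ∘ x` (`ρB g (e ∘ x) = e ∘ ρA g x`).  If `ρA` is irreducible (Mathlib: the lattice of
subrepresentations is simple) then so is `ρB`: the preimage `{x | e ∘ x ∈ W}` of a `ρB`-stable
subspace `W` is a `ρA`-stable subspace, and it is `0` or everything exactly when `W` is.
[folklore] -/
theorem isIrreducible_of_semilinear_transport (e : A ≃+* B)
    {ρA : Representation A G (Fin n → A)} {ρB : Representation B G (Fin n → B)}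
    (hcomm : ∀ (g : G) (x : Fin n → A), ρB g ((e : A → B) ∘ x) = (e : A → B) ∘ ρA g x)
    (hA : ρA.IsIrreducible) : ρB.IsIrreducible := by
  haveI := hA
  -- the ambient space `Aⁿ` is non-trivial, hence so is `Bⁿ`
  have hbtA : (⊥ : Subrepresentation ρA) ≠ ⊤ := bot_ne_top
  have hn : ∃ x : Fin n → A, x ≠ 0 := by
    by_contra hall
    push Not at hall
    apply hbtA
    apply Subrepresentation.toSubmodule_injective
    change (⊥ : Submodule A (Fin n → A)) = ⊤
    exact ((Submodule.eq_bot_iff ⊤).mpr fun x _ => hall x).symm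
  -- the pull-back of a `ρB`-subrepresentation
  let pull : Subrepresentation ρB → Subrepresentation ρA := fun W =>
    { toSubmodule :=
        { carrier := {x | (e : A → B) ∘ x ∈ W}
          add_mem' := by
            intro x y hx hy
            simp only [Set.mem_setOf_eq] at hx hy ⊢
            have : (e : A → B) ∘ (x + y) = (e : A → B) ∘ x + (e : A → B) ∘ y := by
              funext i; simp
            rw [this]
            exact W.toSubmodule.add_mem hx hy
          zero_mem' := by
            simp only [Set.mem_setOf_eq]
            have : (e : A → B) ∘ (0 : Fin n → A) = 0 := by funext i; simp
            rw [this]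
            exact W.toSubmodule.zero_mem
          smul_mem' := by
            intro a x hx
            simp only [Set.mem_setOf_eq] at hx ⊢
            have : (e : A → B) ∘ (a • x) = e a • ((e : A → B) ∘ x) := by
              funext i; simp
            rw [this]
            exact W.toSubmodule.smul_mem _ hx }
      apply_mem_toSubmodule := by
        intro g x hx
        change (e : A → B) ∘ ρA g x ∈ W
        rw [← hcomm g x]
        exact W.apply_mem_toSubmodule g hx }
  have hmem : ∀ (W : Subrepresentation ρB) (x : Fin n → A), x ∈ pull W ↔ (e : A → B) ∘ x ∈ W :=
    fun W x => Iff.rfl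
  have hsurj : ∀ y : Fin n → B, (e : A → B) ∘ ((e.symm : B → A) ∘ y) = y := fun y => by
    funext i; simp
  refine { toNontrivial := ⟨⟨⊥, ⊤, fun hbt => ?_⟩⟩, eq_bot_or_eq_top := fun W => ?_ }
  · obtain ⟨x, hx⟩ := hn
    have hy : (e : A → B) ∘ x ∈ (⊤ : Subrepresentation ρB) := trivial
    rw [← hbt] at hy
    change (e : A → B) ∘ x ∈ (⊥ : Submodule B (Fin n → B)) at hy
    rw [Submodule.mem_bot] at hy
    apply hx
    funext i
    have := congrFun hy i
    simpa using this
  · rcases eq_bot_or_eq_top (pull W) with h0 | h1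
    · left
      apply Subrepresentation.toSubmodule_injective
      change W.toSubmodule = ⊥
      refine (Submodule.eq_bot_iff _).mpr fun y hy => ?_
      have hx : (e.symm : B → A) ∘ y ∈ pull W := by
        rw [hmem, hsurj]; exact hy
      rw [h0] at hx
      change (e.symm : B → A) ∘ y ∈ (⊥ : Submodule A (Fin n → A)) at hx
      rw [Submodule.mem_bot] at hx
      rw [← hsurj y, hx]
      funext i; simp
    · right
      apply Subrepresentation.toSubmodule_injective
      change W.toSubmodule = ⊤
      refine Submodule.eq_top_iff'.mpr fun y => ?_
      have hx : (e.symm : B → A) ∘ y ∈ pull W := by rw [h1]; trivial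
      rw [hmem, hsurj] at hx
      exact hx

end Transport

/-! ## 3. The `ℓ`-adic transport of the contragredient of an Artin representation -/

section Artin

variable {K : Type} [Field K] [NumberField K] {n : ℕ} {ℓ : ℕ} [Fact ℓ.Prime]

/-- **The `ℓ`-adic transport of the contragredient of an Artin representation.**  For
`σ : Γ_K → GL_n(ℂ)` continuous and `ι : ℚ̄_ℓ ≃+* ℂ` there is a continuous
`ρ₀ : Γ_K → GL_n(ℚ̄_ℓ)` with `ρ₀(g) = ι⁻¹(((σ g)⁻¹)ᵀ)` entrywise (continuity: its kernel contains the
open kernel of `σ`, Serre 1968 Ch. I §1.1 Remark, `FramedArtinRep.isOpen_ker_toMonoidHom`,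
`MonoidHom.continuous_of_isOpen_ker`); for every
`g`, `ρ₀ g = 1 ↔ σ g = 1`; and `ρ₀` is irreducible if `σ` is (`FramedRep.isIrreducible_dual` and
`isIrreducible_of_semilinear_transport`).
[cite: SerreAbelianLadic1968, Ch. I §1.1 Remark and Ch. III §2.3] -/
theorem exists_lAdicDualTransport (σ : FramedArtinRep K n) (ι : PadicAlgCl ℓ ≃+* ℂ) :
    ∃ ρ₀ : FramedGaloisRep K (PadicAlgCl ℓ) n,
      (∀ g : Field.absoluteGaloisGroup K,
        ((ρ₀ g : GL (Fin n) (PadicAlgCl ℓ)) : Matrix (Fin n) (Fin n) (PadicAlgCl ℓ)) =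
          ((((σ g)⁻¹ : GL (Fin n) ℂ) : Matrix (Fin n) (Fin n) ℂ)ᵀ).map (ι.symm : ℂ → PadicAlgCl ℓ)) ∧
      (∀ g : Field.absoluteGaloisGroup K, ρ₀ g = 1 ↔ σ g = 1) ∧
      (σ.toGaloisRep.IsIrreducible → ρ₀.toGaloisRep.IsIrreducible) := by
  set τ : FramedArtinRep K n := FramedRep.dual σ with hτ
  set φ : Field.absoluteGaloisGroup K →* GL (Fin n) (PadicAlgCl ℓ) :=
    (Matrix.GeneralLinearGroup.map ((ι.symm : ℂ ≃+* PadicAlgCl ℓ) : ℂ →+* PadicAlgCl ℓ)).comp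
      τ.toMonoidHom with hφ
  -- the kernel dictionary
  have hφτ : ∀ g, φ g = 1 ↔ τ g = 1 := by
    intro g
    rw [← Units.val_eq_one, ← Units.val_eq_one (a := τ g)]
    change (((τ g : GL (Fin n) ℂ) : Matrix (Fin n) (Fin n) ℂ).map
      ((ι.symm : ℂ ≃+* PadicAlgCl ℓ) : ℂ →+* PadicAlgCl ℓ)) = 1 ↔ _
    constructor
    · intro h
      have h1 : (((τ g : GL (Fin n) ℂ) : Matrix (Fin n) (Fin n) ℂ).map
          ((ι.symm : ℂ ≃+* PadicAlgCl ℓ) : ℂ →+* PadicAlgCl ℓ)) =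
          (1 : Matrix (Fin n) (Fin n) ℂ).map ((ι.symm : ℂ ≃+* PadicAlgCl ℓ) : ℂ →+* PadicAlgCl ℓ) := by
        rw [h, Matrix.map_one _ (map_zero _) (map_one _)]
      exact Matrix.map_injective (ι.symm : ℂ ≃+* PadicAlgCl ℓ).injective h1
    · intro h
      rw [h, Matrix.map_one _ (map_zero _) (map_one _)]
  have hτσ : ∀ g, τ g = 1 ↔ σ g = 1 := by
    intro g
    change glTransposeInv (Fin n) ℂ (σ g) = 1 ↔ σ g = 1
    constructor
    · intro h
      have h' := congrArg (fun u : GL (Fin n) ℂ => ((u : GL (Fin n) ℂ) : Matrix (Fin n) (Fin n) ℂ)ᵀ) h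
      simp only [coe_glTransposeInv_apply, Matrix.transpose_transpose, Units.val_one,
        Matrix.transpose_one] at h'
      have h'' : (σ g)⁻¹ = 1 := Units.val_eq_one.mp h'
      exact inv_eq_one.mp h''
    · intro h
      rw [h, map_one]
  -- continuity from the open kernel of `τ`
  have hker : IsOpen (φ.ker : Set (Field.absoluteGaloisGroup K)) := by
    refine Subgroup.isOpen_mono ?_ (FramedArtinRep.isOpen_ker_toMonoidHom τ)
    intro g hg
    rw [MonoidHom.mem_ker] at hg ⊢
    exact (hφτ g).mpr hg
  let ρ₀ : FramedGaloisRep K (PadicAlgCl ℓ) n := ⟨φ, MonoidHom.continuous_of_isOpen_ker φ hker⟩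
  have hρ₀ : ∀ g, ρ₀ g = φ g := fun g => rfl
  refine ⟨ρ₀, fun g => rfl, fun g => (hφτ g).trans (hτσ g), fun hirr => ?_⟩
  -- irreducibility: `σ` irreducible ⇒ `τ = σ^∨` irreducible ⇒ its transport irreducible
  have hτirr : τ.IsIrreducible := FramedRep.isIrreducible_dual σ hirr
  change ρ₀.toRepresentation.IsIrreducible
  refine isIrreducible_of_semilinear_transport (ι.symm : ℂ ≃+* PadicAlgCl ℓ) (ρA := τ.toRepresentation)
    (fun g x => ?_) hτirr
  funext i
  rw [FramedRep.toRepresentation_apply_apply, FramedRep.toRepresentation_apply_apply, hρ₀]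
  change ((((τ g : GL (Fin n) ℂ) : Matrix (Fin n) (Fin n) ℂ).map
      ((ι.symm : ℂ ≃+* PadicAlgCl ℓ) : ℂ →+* PadicAlgCl ℓ)) *ᵥ
        (((ι.symm : ℂ ≃+* PadicAlgCl ℓ) : ℂ →+* PadicAlgCl ℓ) ∘ x)) i =
    ((ι.symm : ℂ ≃+* PadicAlgCl ℓ) : ℂ →+* PadicAlgCl ℓ) ((((τ g : GL (Fin n) ℂ) :
      Matrix (Fin n) (Fin n) ℂ) *ᵥ x) i)
  rw [RingHom.map_mulVec]

/-- **Frobenius on the transport.**  If the arithmetic Frobenii of `σ` at `v` have characteristic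
polynomial `∏_{a ∈ α} (X - a)` (`satakePolynomial α`), then those of any `ρ₀` with
`ρ₀(g) = ι⁻¹(((σ g)⁻¹)ᵀ)` have characteristic polynomial `∏_{a ∈ α} (X - ι⁻¹(a⁻¹))`, i.e.
`arithFrobPolyOfSatake ι q_v 1 α` (transpose-invariance, `charpoly_inv_eq_prod_of_charpoly_eq_prod`,
`Matrix.charpoly_map`). [cite: BuzzardGeeLMS2014, §2.1 and Rem. 3.2.5] -/
theorem hasFrobCharpolyAt_of_lAdicDualTransport {σ : FramedArtinRep K n} {ι : PadicAlgCl ℓ ≃+* ℂ}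
    {ρ₀ : FramedGaloisRep K (PadicAlgCl ℓ) n}
    (hρ₀ : ∀ g : Field.absoluteGaloisGroup K,
      ((ρ₀ g : GL (Fin n) (PadicAlgCl ℓ)) : Matrix (Fin n) (Fin n) (PadicAlgCl ℓ)) =
        ((((σ g)⁻¹ : GL (Fin n) ℂ) : Matrix (Fin n) (Fin n) ℂ)ᵀ).map (ι.symm : ℂ → PadicAlgCl ℓ))
    {v : HeightOneSpectrum (𝓞 K)} {α : Multiset ℂ}
    (h : σ.HasFrobCharpolyAt v (satakePolynomial α)) :
    ρ₀.HasFrobCharpolyAt v (arithFrobPolyOfSatake ι v.residueCard 1 α) := by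
  intro 𝔓 h𝔓 g hg
  have hσ := h 𝔓 h𝔓 g hg
  unfold FramedRep.charpoly at hσ ⊢
  rw [hρ₀ g]
  have hunit : IsUnit ((σ g : GL (Fin n) ℂ) : Matrix (Fin n) (Fin n) ℂ) := Units.isUnit _
  have hinv : (((σ g : GL (Fin n) ℂ) : Matrix (Fin n) (Fin n) ℂ)⁻¹).charpoly =
      (α.map fun a => X - C a⁻¹).prod :=
    charpoly_inv_eq_prod_of_charpoly_eq_prod hunit (by rw [hσ]; rfl)
  have e1 : ((((σ g)⁻¹ : GL (Fin n) ℂ) : Matrix (Fin n) (Fin n) ℂ)ᵀ).map (ι.symm : ℂ → PadicAlgCl ℓ) =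
      ((((σ g : GL (Fin n) ℂ) : Matrix (Fin n) (Fin n) ℂ)⁻¹)ᵀ).map
        (((ι.symm : ℂ ≃+* PadicAlgCl ℓ) : ℂ →+* PadicAlgCl ℓ) : ℂ → PadicAlgCl ℓ) := by
    rw [Matrix.coe_units_inv]; rfl
  rw [e1, Matrix.charpoly_map, Matrix.charpoly_transpose, hinv, arithFrobPolyOfSatake_one,
    map_multisetProd_X_sub_C]
  rfl

/-- **`π = π(σ)` makes the transport an a.e.-compatible avatar.**  If `IsPiOfArtinRep σ π` (Tunnell:
at almost all `v`, `π_v` unramified with Satake parameter `α`, `σ` unramified at `v` with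
`charpoly σ(Frob_v) = ∏_{a ∈ α} (X - a)`), then any `ρ₀` with `ρ₀(g) = ι⁻¹(((σ g)⁻¹)ᵀ)` and
`ρ₀ g = 1 ↔ σ g = 1` is Satake–Frobenius compatible with `(π, ι)` at almost all places
(`Summit.Langlands.SatakeFrobCompatibleAt`: unramified, `charpoly = arithFrobPolyOfSatake ι q_v 1 α`).
[cite: Tunnell1981, p. 173] [cite: BuzzardGeeLMS2014, Conj. 3.2.1 and Rem. 3.2.5] -/
theorem eventually_satakeFrobCompatibleAt_lAdicDualTransport {hcpt : isCompact_glFiniteIntegralLevel n K}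
    {σ : FramedArtinRep K n} {π : AutomorphicRepData (AutomorphyDatum.gl n K hcpt)}
    (hπ : IsPiOfArtinRep σ π) (ι : PadicAlgCl ℓ ≃+* ℂ)
    {ρ₀ : FramedGaloisRep K (PadicAlgCl ℓ) n}
    (hρ₀ : ∀ g : Field.absoluteGaloisGroup K,
      ((ρ₀ g : GL (Fin n) (PadicAlgCl ℓ)) : Matrix (Fin n) (Fin n) (PadicAlgCl ℓ)) =
        ((((σ g)⁻¹ : GL (Fin n) ℂ) : Matrix (Fin n) (Fin n) ℂ)ᵀ).map (ι.symm : ℂ → PadicAlgCl ℓ))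
    (hker : ∀ g : Field.absoluteGaloisGroup K, ρ₀ g = 1 ↔ σ g = 1) :
    ∀ᶠ v : HeightOneSpectrum (𝓞 K) in cofinite, SatakeFrobCompatibleAt ι π ρ₀ v := by
  filter_upwards [hπ] with v hv
  obtain ⟨α, hα, hur, hcp⟩ := hv
  exact ⟨α, hα, fun 𝔓 h𝔓 g hg => (hker g).mpr (hur 𝔓 h𝔓 g hg),
    hasFrobCharpolyAt_of_lAdicDualTransport hρ₀ hcp⟩

/-- **An irreducible a.e.-compatible avatar of a Galois-type `π`.**  If `π = π(σ)` for an
irreducible Artin representation `σ : Γ_K → GL_n(ℂ)`, then for every `ℓ` and `ι : ℚ̄_ℓ ≃+* ℂ` there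
is an IRREDUCIBLE `ρ₀ : Γ_K →ₜ* GL_n(ℚ̄_ℓ)` Satake–Frobenius compatible with `(π, ι)` at almost all
places (the `ℓ`-adic transport of `σ^∨`). [cite: SerreAbelianLadic1968, Ch. III §2.3]
[cite: Tunnell1981, p. 173] -/
theorem exists_irreducible_avatar_of_isPiOfArtinRep {hcpt : isCompact_glFiniteIntegralLevel n K}
    {σ : FramedArtinRep K n} (hσ : σ.toGaloisRep.IsIrreducible)
    {π : AutomorphicRepData (AutomorphyDatum.gl n K hcpt)} (hπ : IsPiOfArtinRep σ π)
    (ι : PadicAlgCl ℓ ≃+* ℂ) :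
    ∃ ρ₀ : FramedGaloisRep K (PadicAlgCl ℓ) n, ρ₀.toGaloisRep.IsIrreducible ∧
      ∀ᶠ v : HeightOneSpectrum (𝓞 K) in cofinite, SatakeFrobCompatibleAt ι π ρ₀ v := by
  obtain ⟨ρ₀, hρ₀, hker, hirr⟩ := exists_lAdicDualTransport σ ι
  exact ⟨ρ₀, hirr hσ, eventually_satakeFrobCompatibleAt_lAdicDualTransport hπ ι hρ₀ hker⟩

end Artin

section Region

/-- **The Galois-type region of `IrreducibleOffSector` (every rank, every number field,
unconditional).**  Let `π` be an automorphic representation datum of `GL_n(𝔸_K)` with `π = π(σ)`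
(`IsPiOfArtinRep σ π`) for an IRREDUCIBLE Artin representation `σ : Γ_K → GL_n(ℂ)`.
Then for every prime `ℓ`, every `ι : ℚ̄_ℓ ≃+* ℂ` and every continuous `ρ : Γ_K → GL_n(ℚ̄_ℓ)`
Satake–Frobenius compatible with `(π, ι)` at almost all places, `ρ` is irreducible: the irreducible
avatar of `exists_irreducible_avatar_of_isPiOfArtinRep` transfers its irreducibility to `ρ` by
Chebotarev + Brauer–Nesbitt (`isIrreducible_of_satakeFrobCompatible`, p79199).  No cuspidality,
algebraicity or regularity hypothesis on `π` is used. [cite: DeligneSerreASENS1974, Lemme 3.2]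
[cite: Tunnell1981, p. 173] -/
theorem isIrreducible_of_isPiOfArtinRep {K : Type} [Field K] [NumberField K] {n ℓ : ℕ}
    [Fact ℓ.Prime] {hcpt : isCompact_glFiniteIntegralLevel n K}
    (π : AutomorphicRepData (AutomorphyDatum.gl n K hcpt)) {σ : FramedArtinRep K n}
    (hσ : σ.toGaloisRep.IsIrreducible) (hπ : IsPiOfArtinRep σ π)
    (ι : PadicAlgCl ℓ ≃+* ℂ) (ρ : FramedGaloisRep K (PadicAlgCl ℓ) n)
    (hρ : ∀ᶠ v : HeightOneSpectrum (𝓞 K) in cofinite, SatakeFrobCompatibleAt ι π ρ v) :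
    ρ.toGaloisRep.IsIrreducible := by
  obtain ⟨ρ₀, hirr₀, h₀⟩ := exists_irreducible_avatar_of_isPiOfArtinRep hσ hπ ι
  exact isIrreducible_of_satakeFrobCompatible π ι hirr₀ h₀ hρ

end Region

end Summit.Langlands.Langlands.Theorems.IrreducibleOffSector

end
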